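import Summits.ValiantsHypothesis.ValiantsHypothesis.Theorems.LacunarySymmetroidMatrixDescartesCensusNewtonS0
import Summits.ValiantsHypothesis.ValiantsHypothesis.Theorems.LacunarySymmetroidMatrixDescartesCensusSignClass
import Summits.ValiantsHypothesis.ValiantsHypothesis.Theorems.LacunarySymmetroidMatrixDescartesCensusLorentzRows

/-!
# `MatrixDescartes` census — the DOOR-B BRIDGE: THEOREM L-N (a) as a kernel theorem about PENCILS

HONEST FRAMING.  Object-search cell `pub-symmetroid`, route crux `Theses.LacunarySymmetroid.MatrixDescartes`
(ledger item stmt-ValiantsHypothesis-18050).  In the cell's dictionary «door B» is a HYPOTHETICAL `(2,5)` FOURTEEN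
(a real symmetric `2 × 2` five-term lacunary pencil with `14 = D(2,5)` distinct positive determinant roots) whose two
END letters are both indefinite («II-ended»); engine-1 g13's DOORB-GRAM note (R1) reduced «door B EMPTY on the
class-G Sidon support `d`» to CONJECTURE L(d) (`Φ > 0`), and engine-1 g14's THEOREM L-N (a) — in the kernel as
`Census.newton_s0_window` (engine-6 g16, `…CensusNewtonS0.lean`) — proves `Φ > 0` on every «Newton-good» support
(`M_W(d) ≥ 0`, a support-only integer condition).  Until now the kernel statement was about the coefficients of ONE
real polynomial; this file supplies the bridge to pencils, which needs no Sylvester/interlacing argument, only the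
tree's Gram identity `Census.gram_three_eq_sq` (`…CensusLorentzRows.lean`, typer g4):
`4u₀u₃u₅ + u₁u₂u₄ − u₀u₄² − u₃u₂² − u₅u₁² = det[S_a|S_b|S_c]² ≥ 0` for the six low determinant coefficients
`u = (det S_a, 2B(S_a,S_b), 2B(S_a,S_c), det S_b, 2B(S_b,S_c), det S_c)` of three symmetric letters
(`(Sym₂(ℝ), det) ≅ ℝ^{1,2}`).  Under the full sign alternation of a Descartes-sharp determinant the left side is
`sign(u₀)·Φ(|u|)`, so `Φ(|u|) > 0` forces `u₀ = det S_a > 0`: the bottom letter is DEFINITE and the global sign is `+`.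

* `pos_of_gram_nonneg_of_window` — the sign lemma just described (pure real arithmetic).
* `card_filter_lt_orderEmbOfFin`, `orderEmbOfFin_eq_of_rank`, `cast_natDist` — bookkeeping: the element of rank `r`
  of a finite set of naturals is its `r`-th element in increasing order; `Nat.dist` casts to `|· − ·|`.
* **`doorB_window_of_newtonGood`** — THE BRIDGE: for ANY number of terms `K`, any exponents `d` and three letters
  `a, b, c` whose six knots `2d_a, d_a+d_b, d_a+d_c, 2d_b, d_b+d_c, 2d_c` are uncollided and are the six lowest pair
  sums (ranks `0..5` — the class-G shape), with the Newton condition `M_W ≥ 0` stated in natural-number distances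
  (decidable per support): if `det F` has at least `#W − 1` distinct positive roots then EVERY coefficient of `det F`
  has sign `(−1)^{rank}` and every letter with an uncollided square knot has `sign det S_i = (−1)^{rank(2d_i)}` —
  in particular `det S_a > 0`: NO such pencil has an indefinite bottom letter, a fortiori none is II-ended.
* `doorB_word_on_2_5_0_2_3_8_35` — instance on the support of the census's first fourteen (R1): every real symmetric
  `2 × 2` pencil on `(0,2,3,8,35)` with `≥ 14` distinct positive roots has word `D I I I D` (all hypotheses by `decide`).

Scope (engine-1 g14, THEOREM-LN-E1G14.md §3/§5, two codes): Newton-good are 29 591 of the 44 555 class-G Sidon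
supports with `d₄ ≤ 60` and 52 of the 86 census fourteen supports (all `(0,2,3,·,·)`, `(0,3,4,·,·)`, `(0,3,5,·,·)`);
NOT the `(0,4,5,11,N)` column, `(0,5,6,13,73)`, `(0,6,7,15,85)`, `(0,7,8,17,97)`, `d* = (0,8,9,19,124)` (there door B
is closed by the cell's certificates, not by this theorem).  Nothing here bears on `ζ_sym`, on `DoorA26` / `DoorA34`
(OPEN), on the crux `MatrixDescartes` or on `VP ≠ VNP`.

[folklore] — elementary; the cell's own chain DOORB-GRAM (engine-1 g13) → THEOREM L-N (engine-1 g14, kernel by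
engine-6 g16) → this bridge (engine-1 g15).
-/

-- `Summit.ValiantsHypothesis.ValiantsHypothesis.…` repeats a component by the D-0017 layout
-- (single-conjunct summit), which the `dupNamespace` linter flags; the name is mandated.
set_option linter.dupNamespace false

namespace Summit.ValiantsHypothesis.ValiantsHypothesis.Theorems.LacunarySymmetroidMatrixDescartes.Census

open Polynomial Finset
open scoped BigOperators Polynomial Matrix

/-- **Sign lemma of the bridge.**  Six reals `u₀,…,u₅` whose «Gram form»
`4u₀u₃u₅ + u₁u₂u₄ − u₀u₄² − u₃u₂² − u₅u₁²` is non-negative, which alternate in sign relative to `u₀`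
(`u₀u₁ < 0`, `u₀u₂ > 0`, `u₀u₃ < 0`, `u₀u₄ > 0`, `u₀u₅ < 0`) and whose absolute values satisfy
`Φ = 4|u₀||u₃||u₅| + |u₁|²|u₅| + |u₂|²|u₃| − |u₀||u₄|² − |u₁||u₂||u₄| > 0`, have `u₀ > 0`:
for `u₀ < 0` the Gram form equals `−Φ`. [folklore] -/
theorem pos_of_gram_nonneg_of_window {u₀ u₁ u₂ u₃ u₄ u₅ : ℝ}
    (hG : 0 ≤ 4 * u₀ * u₃ * u₅ + u₁ * u₂ * u₄ - u₀ * u₄ ^ 2 - u₃ * u₂ ^ 2 - u₅ * u₁ ^ 2)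
    (h01 : u₀ * u₁ < 0) (h02 : 0 < u₀ * u₂) (h03 : u₀ * u₃ < 0) (h04 : 0 < u₀ * u₄) (h05 : u₀ * u₅ < 0)
    (hΦ : 0 < 4 * |u₀| * |u₃| * |u₅| + |u₁| ^ 2 * |u₅| + |u₂| ^ 2 * |u₃| - |u₀| * |u₄| ^ 2
      - |u₁| * |u₂| * |u₄|) :
    0 < u₀ := by
  rcases lt_trichotomy u₀ 0 with h0 | h0 | h0
  · exfalso
    have h1 : 0 < u₁ := by nlinarith
    have h2 : u₂ < 0 := by nlinarith
    have h3 : 0 < u₃ := by nlinarith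
    have h4 : u₄ < 0 := by nlinarith
    have h5 : 0 < u₅ := by nlinarith
    rw [abs_of_neg h0, abs_of_pos h1, abs_of_neg h2, abs_of_pos h3, abs_of_neg h4, abs_of_pos h5] at hΦ
    nlinarith
  · exfalso; rw [h0, zero_mul] at h02; exact lt_irrefl _ h02
  · exact h0

/-- The rank of the `j`-th element of a finite set of naturals (in increasing order) is `j`:
`#{x ∈ s | x < s.orderEmbOfFin h j} = j`. [folklore] -/
theorem card_filter_lt_orderEmbOfFin (s : Finset ℕ) {k : ℕ} (h : s.card = k) (j : Fin k) :
    (s.filter (· < s.orderEmbOfFin h j)).card = j := by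
  have hset : s.filter (· < s.orderEmbOfFin h j)
      = (Finset.Iio j).image (s.orderEmbOfFin h) := by
    ext x
    simp only [Finset.mem_filter, Finset.mem_image, Finset.mem_Iio]
    constructor
    · rintro ⟨hx, hlt⟩
      obtain ⟨i, rfl⟩ : x ∈ Set.range (s.orderEmbOfFin h) := by
        rw [Finset.range_orderEmbOfFin]; exact hx
      exact ⟨i, (s.orderEmbOfFin h).lt_iff_lt.mp hlt, rfl⟩
    · rintro ⟨i, hi, rfl⟩
      exact ⟨Finset.orderEmbOfFin_mem _ _ _, (s.orderEmbOfFin h).lt_iff_lt.mpr hi⟩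
  rw [hset, Finset.card_image_of_injective _ (s.orderEmbOfFin h).injective, Fin.card_Iio]

/-- The element of rank `r` of a finite set of naturals is its `r`-th element in increasing order:
if `x ∈ s` and `#{y ∈ s | y < x} = r` then `s.orderEmbOfFin h ⟨r, _⟩ = x`. [folklore] -/
theorem orderEmbOfFin_eq_of_rank (s : Finset ℕ) {k : ℕ} (h : s.card = k) {x : ℕ} (hx : x ∈ s)
    {r : ℕ} (hr : r < k) (hrank : (s.filter (· < x)).card = r) :
    s.orderEmbOfFin h ⟨r, hr⟩ = x := by
  obtain ⟨j, rfl⟩ : x ∈ Set.range (s.orderEmbOfFin h) := by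
    rw [Finset.range_orderEmbOfFin]; exact hx
  rw [card_filter_lt_orderEmbOfFin] at hrank
  congr 1
  exact Fin.ext hrank.symm

/-- `Nat.dist` is the distance of the casts: `(Nat.dist m n : ℝ) = |(m : ℝ) − n|`. [folklore] -/
theorem cast_natDist (m n : ℕ) : ((Nat.dist m n : ℕ) : ℝ) = |(m : ℝ) - n| := by
  rcases le_total m n with h | h
  · rw [Nat.dist_eq_sub_of_le h, Nat.cast_sub h, abs_sub_comm, abs_of_nonneg (by
      rw [sub_nonneg]; exact_mod_cast h)]
  · rw [Nat.dist_comm, Nat.dist_eq_sub_of_le h, Nat.cast_sub h, abs_of_nonneg (by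
      rw [sub_nonneg]; exact_mod_cast h)]

/-- **THE DOOR-B BRIDGE (kernel form of «THEOREM L-N (a) ⟹ door B EMPTY»).**  Let `F = ∑ l, X^{d l} • S l` be a
real symmetric `2 × 2` lacunary pencil (`S l` symmetric, any number of terms `K`), `W` the set of pair sums of `d`,
and `a, b, c` three letters whose six knots `2d_a < d_a+d_b < d_a+d_c < 2d_b < d_b+d_c < 2d_c` are UNCOLLIDED in `W`
and are the six LOWEST elements of `W` (ranks `0,…,5`; this is the «class-G» shape `d_c − d_a < 2(d_b − d_a)` of the
three lowest exponents, and it forces the gap shape of `Census.newton_s0_window`).  Suppose the support-only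
NEWTON CONDITION `M_W ≥ 0` holds, written with natural-number distances
(`π(x) = ∏_{u ∈ W, u ≠ x} |x − u|`: `π(2d_a)π(d_a+d_c)π(2d_b)π(d_b+d_c) + π(d_a+d_b)π(d_a+d_c)²π(2d_b) ≤ π(2d_a)π(d_a+d_b)π(d_b+d_c)²`,
decidable for every concrete `d`).  If `det F` has at least `#W − 1` distinct positive roots (Descartes-sharp at
support resolution — e.g. a `(2,5)` FOURTEEN on a Sidon support), then `det S_a > 0`, `det S_b < 0`, `det S_c < 0`,
and the sign of EVERY coefficient of `det F` is `(−1)^{rank}`: the global sign is `+`, so the D/I type of every letter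
with an uncollided square knot is the parity of that knot's rank (word `DIIID` on the census fourteen road).  In the
cell's dictionary: NO fourteen on such a support has an indefinite bottom letter — a fortiori no «II-ended» fourteen:
DOOR B IS EMPTY on every Newton-good class-G support, as a kernel theorem about pencils.
PROOF.  Sharpness gives full support `W` and full alternation (`pow_rank_mul_coeff_mul_coeff_pos_of_sharp`), so the six
low coefficients `u = (det S_a, 2B(S_a,S_b), 2B(S_a,S_c), det S_b, 2B(S_b,S_c), det S_c)` (dictionary
`coeff_det_pencil_two_diag/pair`) alternate; `Census.newton_s0_window` (engine-1 g14's THEOREM L-N (a)) gives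
`Φ(|u|) > 0`; the Gram identity `gram_three_eq_sq` (`4u₀u₃u₅ + u₁u₂u₄ − u₀u₄² − u₃u₂² − u₅u₁² = det[S_a|S_b|S_c]² ≥ 0`,
i.e. `(Sym₂(ℝ), det) ≅ ℝ^{1,2}` has a Gram determinant of sign `+`) equals `sign(u₀)·Φ(|u|)` under alternation, whence
`u₀ > 0` (`pos_of_gram_nonneg_of_window`).  (engine-1 g15; dictionary engine-1 g13 DOORB-GRAM §1, L-N engine-1 g14.)
Honest framing: a theorem about HYPOTHETICAL sharp pencils on Newton-good supports; nothing on `ζ_sym`, `DoorA26`,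
`DoorA34`, the crux `MatrixDescartes` or `VP ≠ VNP`. [folklore] -/
theorem doorB_window_of_newtonGood {K : ℕ} (d : Fin K → ℕ) (a b c : Fin K)
    (hab : a ≠ b) (hbc : b ≠ c) (hac : a ≠ c)
    (u₁ : ∀ p : Fin K × Fin K, d p.1 + d p.2 = d a + d a → p = (a, a))
    (u₂ : ∀ p : Fin K × Fin K, d p.1 + d p.2 = d b + d b → p = (b, b))
    (u₃ : ∀ p : Fin K × Fin K, d p.1 + d p.2 = d c + d c → p = (c, c))
    (u₄ : ∀ p : Fin K × Fin K, d p.1 + d p.2 = d a + d b → p = (a, b) ∨ p = (b, a))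
    (u₅ : ∀ p : Fin K × Fin K, d p.1 + d p.2 = d a + d c → p = (a, c) ∨ p = (c, a))
    (u₆ : ∀ p : Fin K × Fin K, d p.1 + d p.2 = d b + d c → p = (b, c) ∨ p = (c, b))
    (hrank : let W := (Finset.univ : Finset (Fin K × Fin K)).image (fun p => d p.1 + d p.2)
      (W.filter (· < d a + d a)).card = 0 ∧ (W.filter (· < d a + d b)).card = 1 ∧
        (W.filter (· < d a + d c)).card = 2 ∧ (W.filter (· < d b + d b)).card = 3 ∧
        (W.filter (· < d b + d c)).card = 4 ∧ (W.filter (· < d c + d c)).card = 5)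
    (hM : let W := (Finset.univ : Finset (Fin K × Fin K)).image (fun p => d p.1 + d p.2)
      (∏ u ∈ W.erase (d a + d a), Nat.dist (d a + d a) u) * (∏ u ∈ W.erase (d a + d c), Nat.dist (d a + d c) u)
          * (∏ u ∈ W.erase (d b + d b), Nat.dist (d b + d b) u) * (∏ u ∈ W.erase (d b + d c), Nat.dist (d b + d c) u)
        + (∏ u ∈ W.erase (d a + d b), Nat.dist (d a + d b) u) * (∏ u ∈ W.erase (d a + d c), Nat.dist (d a + d c) u) ^ 2
          * (∏ u ∈ W.erase (d b + d b), Nat.dist (d b + d b) u)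
      ≤ (∏ u ∈ W.erase (d a + d a), Nat.dist (d a + d a) u) * (∏ u ∈ W.erase (d a + d b), Nat.dist (d a + d b) u)
          * (∏ u ∈ W.erase (d b + d c), Nat.dist (d b + d c) u) ^ 2)
    (S : Fin K → Matrix (Fin 2) (Fin 2) ℝ) (hS : ∀ l, (S l).IsSymm)
    (hZ : ((Finset.univ : Finset (Fin K × Fin K)).image (fun p => d p.1 + d p.2)).card ≤
      ((∑ l, ((X : ℝ[X]) ^ d l) • (S l).map C).det.roots.toFinset.filter (fun t => 0 < t)).card + 1) :
    (∀ x ∈ (Finset.univ : Finset (Fin K × Fin K)).image (fun p => d p.1 + d p.2),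
        0 < (-1 : ℝ) ^ (((Finset.univ : Finset (Fin K × Fin K)).image (fun p => d p.1 + d p.2)).filter
              (· < x)).card * (∑ l, ((X : ℝ[X]) ^ d l) • (S l).map C).det.coeff x) ∧
      ∀ i : Fin K, (∀ p : Fin K × Fin K, d p.1 + d p.2 = d i + d i → p = (i, i)) →
        0 < (-1 : ℝ) ^ (((Finset.univ : Finset (Fin K × Fin K)).image (fun p => d p.1 + d p.2)).filter
              (· < d i + d i)).card * (S i).det := by
  classical
  obtain ⟨hr0, hr1, hr2, hr3, hr4, hr5⟩ := hrank
  have hM₀ := hM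
  dsimp only at hM₀
  clear hM
  set P := (∑ l, ((X : ℝ[X]) ^ d l) • (S l).map C).det with hP_def
  set W := (Finset.univ : Finset (Fin K × Fin K)).image (fun p => d p.1 + d p.2) with hW_def
  have memW : ∀ x y : Fin K, d x + d y ∈ W := fun x y =>
    Finset.mem_image.mpr ⟨(x, y), Finset.mem_univ _, rfl⟩
  -- `W` has at least six elements (there is an element of rank 5)
  have h6 : 6 ≤ W.card := by
    have hlt : (W.filter (· < d c + d c)).card < W.card :=
      Finset.card_lt_card (Finset.filter_ssubset.mpr ⟨d c + d c, memW c c, lt_irrefl _⟩)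
    omega
  have hP : P ≠ 0 := by
    intro h0
    have : (P.roots.toFinset.filter (fun t => 0 < t)).card = 0 := by rw [h0]; simp
    omega
  -- full support and full alternation (F1)
  have hsupp : P.support = W := by
    have hsub : P.support ⊆ W := by
      rw [hP_def, hW_def, ← sumset_two_eq_pairSums d]; exact support_det_pencil_subset_sumset d S
    refine Finset.eq_of_subset_of_card_le hsub ?_
    have h := Literature.Computability.AlgebraicComplexity.card_roots_toFinset_filter_pos_lt_card_support hP
    omega
  have hZ' : P.support.card ≤ (P.roots.toFinset.filter (fun t => 0 < t)).card + 1 := by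
    rw [hsupp]; exact hZ
  have F1 : ∀ x y : ℕ, x ∈ W → y ∈ W →
      0 < (-1 : ℝ) ^ ((W.filter (· < x)).card + (W.filter (· < y)).card) * (P.coeff x * P.coeff y) := by
    intro x y hx hy
    have := pow_rank_mul_coeff_mul_coeff_pos_of_sharp P hZ' (by rw [hsupp]; exact hx)
      (by rw [hsupp]; exact hy)
    rwa [hsupp] at this
  -- the dictionary (F0)
  have hsym : ∀ l, S l 1 0 = S l 0 1 := fun l => by
    have h := congrFun (congrFun (hS l) 1) 0
    simp only [Matrix.transpose_apply] at h
    exact h.symm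
  have hdiag : ∀ i : Fin K, (∀ p : Fin K × Fin K, d p.1 + d p.2 = d i + d i → p = (i, i)) →
      P.coeff (d i + d i) = S i 0 0 * S i 1 1 - S i 0 1 ^ 2 := by
    intro i hu; rw [hP_def, coeff_det_pencil_two_diag d S i hu, hsym, sq]
  have hpair : ∀ i j : Fin K, i ≠ j →
      (∀ p : Fin K × Fin K, d p.1 + d p.2 = d i + d j → p = (i, j) ∨ p = (j, i)) →
      P.coeff (d i + d j) = S i 0 0 * S j 1 1 + S i 1 1 * S j 0 0 - 2 * (S i 0 1 * S j 0 1) := by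
    intro i j hij hu; rw [hP_def, coeff_det_pencil_two_pair d S hij hu, hsym, hsym]; ring
  -- the six low coefficients
  set c0 := P.coeff (d a + d a) with hc0
  set c1 := P.coeff (d a + d b) with hc1
  set c2 := P.coeff (d a + d c) with hc2
  set c3 := P.coeff (d b + d b) with hc3
  set c4 := P.coeff (d b + d c) with hc4
  set c5 := P.coeff (d c + d c) with hc5
  have e0 : c0 = S a 0 0 * S a 1 1 - S a 0 1 ^ 2 := by rw [hc0, hdiag a u₁]
  have e1 : c1 = S a 0 0 * S b 1 1 + S a 1 1 * S b 0 0 - 2 * (S a 0 1 * S b 0 1) := by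
    rw [hc1, hpair a b hab u₄]
  have e2 : c2 = S a 0 0 * S c 1 1 + S a 1 1 * S c 0 0 - 2 * (S a 0 1 * S c 0 1) := by
    rw [hc2, hpair a c hac u₅]
  have e3 : c3 = S b 0 0 * S b 1 1 - S b 0 1 ^ 2 := by rw [hc3, hdiag b u₂]
  have e4 : c4 = S b 0 0 * S c 1 1 + S b 1 1 * S c 0 0 - 2 * (S b 0 1 * S c 0 1) := by
    rw [hc4, hpair b c hbc u₆]
  have e5 : c5 = S c 0 0 * S c 1 1 - S c 0 1 ^ 2 := by rw [hc5, hdiag c u₃]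
  -- relative signs (alternation on ranks 0..5)
  have s01 : c0 * c1 < 0 := by
    have h := F1 _ _ (memW a a) (memW a b); rw [hr0, hr1] at h; norm_num at h; linarith
  have s02 : 0 < c0 * c2 := by
    have h := F1 _ _ (memW a a) (memW a c); rw [hr0, hr2] at h; norm_num at h; linarith
  have s03 : c0 * c3 < 0 := by
    have h := F1 _ _ (memW a a) (memW b b); rw [hr0, hr3] at h; norm_num at h; linarith
  have s04 : 0 < c0 * c4 := by
    have h := F1 _ _ (memW a a) (memW b c); rw [hr0, hr4] at h; norm_num at h; linarith
  have s05 : c0 * c5 < 0 := by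
    have h := F1 _ _ (memW a a) (memW c c); rw [hr0, hr5] at h; norm_num at h; linarith
  -- the Gram inequality: `(Sym₂, det)` has signature `(1,2)`
  have hG : 0 ≤ 4 * c0 * c3 * c5 + c1 * c2 * c4 - c0 * c4 ^ 2 - c3 * c2 ^ 2 - c5 * c1 ^ 2 := by
    have key := gram_three_eq_sq (S a 0 0) (S a 0 1) (S a 1 1) (S b 0 0) (S b 0 1) (S b 1 1)
      (S c 0 0) (S c 0 1) (S c 1 1)
    rw [e0, e1, e2, e3, e4, e5]
    nlinarith [key, sq_nonneg (S a 0 0 * (S b 0 1 * S c 1 1 - S b 1 1 * S c 0 1)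
      - S a 0 1 * (S b 0 0 * S c 1 1 - S b 1 1 * S c 0 0) + S a 1 1 * (S b 0 0 * S c 0 1 - S b 0 1 * S c 0 0))]
  -- THEOREM L-N (a) on the indexed form of `P`
  set n := W.card with hn
  set e : Fin n ↪o ℕ := W.orderEmbOfFin hn.symm with he_def
  have he : StrictMono e := e.strictMono
  have hinj : Function.Injective e := e.injective
  have himage : Finset.univ.image e = W := Finset.image_orderEmbOfFin_univ _ _
  have hf : (∑ t, C (P.coeff (e t)) * X ^ (e t)) = P := by
    have h1 : ∑ u ∈ Finset.univ.image e, C (P.coeff u) * X ^ u = ∑ t, C (P.coeff (e t)) * X ^ (e t) :=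
      Finset.sum_image hinj.injOn
    rw [← h1, himage, ← hsupp]
    exact P.as_sum_support_C_mul_X_pow.symm
  have hc : ∀ t, P.coeff (e t) ≠ 0 := by
    intro t
    have : e t ∈ P.support := by rw [hsupp, ← himage]; exact Finset.mem_image_of_mem _ (Finset.mem_univ t)
    exact Polynomial.mem_support_iff.mp this
  have hZ'' : n ≤ ((∑ t, C (P.coeff (e t)) * X ^ (e t)).roots.toFinset.filter
      (fun x => 0 < x)).card + 1 := by
    rw [hf]; exact hZ
  have he0 : e ⟨0, by omega⟩ = d a + d a := orderEmbOfFin_eq_of_rank W hn.symm (memW a a) _ hr0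
  have he1 : e ⟨1, by omega⟩ = d a + d b := orderEmbOfFin_eq_of_rank W hn.symm (memW a b) _ hr1
  have he2 : e ⟨2, by omega⟩ = d a + d c := orderEmbOfFin_eq_of_rank W hn.symm (memW a c) _ hr2
  have he3 : e ⟨3, by omega⟩ = d b + d b := orderEmbOfFin_eq_of_rank W hn.symm (memW b b) _ hr3
  have he4 : e ⟨4, by omega⟩ = d b + d c := orderEmbOfFin_eq_of_rank W hn.symm (memW b c) _ hr4
  have he5 : e ⟨5, by omega⟩ = d c + d c := orderEmbOfFin_eq_of_rank W hn.symm (memW c c) _ hr5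
  have hlt01 : d a + d a < d a + d b := by
    rw [← he0, ← he1]; exact he (Fin.mk_lt_mk.mpr (by norm_num))
  have hlt12 : d a + d b < d a + d c := by
    rw [← he1, ← he2]; exact he (Fin.mk_lt_mk.mpr (by norm_num))
  have hlt23 : d a + d c < d b + d b := by
    rw [← he2, ← he3]; exact he (Fin.mk_lt_mk.mpr (by norm_num))
  have hgap1 : e ⟨1, by omega⟩ - e ⟨0, by omega⟩
      = (e ⟨2, by omega⟩ - e ⟨1, by omega⟩) + (e ⟨3, by omega⟩ - e ⟨2, by omega⟩) := by
    rw [he0, he1, he2, he3]; omega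
  have hgap2 : e ⟨4, by omega⟩ - e ⟨3, by omega⟩ = e ⟨2, by omega⟩ - e ⟨1, by omega⟩ := by
    rw [he1, he2, he3, he4]; omega
  -- the `π` products over `Fin n` are the natural-number products over `W`
  have hπ : ∀ t : Fin n, ∏ u ∈ univ.erase t, |((e t : ℕ) : ℝ) - e u|
      = ((∏ u ∈ W.erase (e t), Nat.dist (e t) u : ℕ) : ℝ) := by
    intro t
    rw [← himage, ← Finset.image_erase hinj, Finset.prod_image hinj.injOn]
    push_cast
    exact Finset.prod_congr rfl fun u _ => (cast_natDist _ _).symm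
  have key := newton_s0_window h6 e he (fun t => P.coeff (e t)) hc hZ'' hgap1 hgap2 (by
    simp only [hπ]
    rw [he0, he1, he2, he3, he4]
    exact_mod_cast hM₀)
  simp only [] at key
  rw [he0, he1, he2, he3, he4, he5] at key
  -- the bridge
  have hc0pos : 0 < c0 :=
    pos_of_gram_nonneg_of_window (by linarith [hG]) s01 s02 s03 s04 s05 key
  -- conclusions
  have hall : ∀ x ∈ W, 0 < (-1 : ℝ) ^ (W.filter (· < x)).card * P.coeff x := by
    intro x hx
    have h := F1 _ _ (memW a a) hx
    rw [hr0, zero_add] at h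
    have h' : 0 < c0 * ((-1 : ℝ) ^ (W.filter (· < x)).card * P.coeff x) := by
      have := h; ring_nf at this ⊢; linarith
    exact (mul_pos_iff_of_pos_left hc0pos).mp h'
  have hletter : ∀ i : Fin K, (∀ p : Fin K × Fin K, d p.1 + d p.2 = d i + d i → p = (i, i)) →
      0 < (-1 : ℝ) ^ (W.filter (· < d i + d i)).card * (S i).det := by
    intro i hu
    have hdet : (S i).det = P.coeff (d i + d i) := by rw [Matrix.det_fin_two, hsym, hdiag i hu, sq]
    rw [hdet]
    exact hall _ (memW i i)
  exact ⟨hall, hletter⟩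


/-- **Instance (census fourteen road, kernel): door B on `(0,2,3,8,35)`.**  On the support of the census's first
`(2,5)` FOURTEEN (row R1) — class G, Sidon, Newton-good (`M_W ≥ 0` by `decide`) — every real symmetric `2 × 2` pencil
with at least `14` distinct positive roots of its determinant has the word `D I I I D`:
`det S₀ > 0`, `det S₁ < 0`, `det S₂ < 0`, `det S₃ < 0`, `det S₄ > 0`.  In particular no such pencil is «II-ended»
(door B is EMPTY on this support), as a theorem about pencils. [folklore] -/
theorem doorB_word_on_2_5_0_2_3_8_35 (S : Fin 5 → Matrix (Fin 2) (Fin 2) ℝ) (hS : ∀ l, (S l).IsSymm)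
    (h14 : 14 ≤ ((∑ l, ((X : ℝ[X]) ^ (![0, 2, 3, 8, 35] : Fin 5 → ℕ) l) • (S l).map C).det.roots.toFinset.filter
      (fun t => 0 < t)).card) :
    0 < (S 0).det ∧ (S 1).det < 0 ∧ (S 2).det < 0 ∧ (S 3).det < 0 ∧ 0 < (S 4).det := by
  have hW : ((Finset.univ : Finset (Fin 5 × Fin 5)).image
      (fun p => (![0, 2, 3, 8, 35] : Fin 5 → ℕ) p.1 + (![0, 2, 3, 8, 35] : Fin 5 → ℕ) p.2)).card = 15 := by
    decide
  obtain ⟨-, h⟩ := doorB_window_of_newtonGood (![0, 2, 3, 8, 35] : Fin 5 → ℕ) 0 1 2 (by decide) (by decide)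
    (by decide) (by decide) (by decide) (by decide) (by decide) (by decide) (by decide) (by decide) (by decide)
    S hS (by rw [hW]; exact Nat.succ_le_succ h14)
  have h0 := h 0 (by decide)
  have h1 := h 1 (by decide)
  have h2 := h 2 (by decide)
  have h3 := h 3 (by decide)
  have h4 := h 4 (by decide)
  rw [show (((Finset.univ : Finset (Fin 5 × Fin 5)).image
      (fun p => (![0, 2, 3, 8, 35] : Fin 5 → ℕ) p.1 + (![0, 2, 3, 8, 35] : Fin 5 → ℕ) p.2)).filter
      (· < (![0, 2, 3, 8, 35] : Fin 5 → ℕ) 0 + (![0, 2, 3, 8, 35] : Fin 5 → ℕ) 0)).card = 0 by decide] at h0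
  rw [show (((Finset.univ : Finset (Fin 5 × Fin 5)).image
      (fun p => (![0, 2, 3, 8, 35] : Fin 5 → ℕ) p.1 + (![0, 2, 3, 8, 35] : Fin 5 → ℕ) p.2)).filter
      (· < (![0, 2, 3, 8, 35] : Fin 5 → ℕ) 1 + (![0, 2, 3, 8, 35] : Fin 5 → ℕ) 1)).card = 3 by decide] at h1
  rw [show (((Finset.univ : Finset (Fin 5 × Fin 5)).image
      (fun p => (![0, 2, 3, 8, 35] : Fin 5 → ℕ) p.1 + (![0, 2, 3, 8, 35] : Fin 5 → ℕ) p.2)).filter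
      (· < (![0, 2, 3, 8, 35] : Fin 5 → ℕ) 2 + (![0, 2, 3, 8, 35] : Fin 5 → ℕ) 2)).card = 5 by decide] at h2
  rw [show (((Finset.univ : Finset (Fin 5 × Fin 5)).image
      (fun p => (![0, 2, 3, 8, 35] : Fin 5 → ℕ) p.1 + (![0, 2, 3, 8, 35] : Fin 5 → ℕ) p.2)).filter
      (· < (![0, 2, 3, 8, 35] : Fin 5 → ℕ) 3 + (![0, 2, 3, 8, 35] : Fin 5 → ℕ) 3)).card = 9 by decide] at h3
  rw [show (((Finset.univ : Finset (Fin 5 × Fin 5)).image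
      (fun p => (![0, 2, 3, 8, 35] : Fin 5 → ℕ) p.1 + (![0, 2, 3, 8, 35] : Fin 5 → ℕ) p.2)).filter
      (· < (![0, 2, 3, 8, 35] : Fin 5 → ℕ) 4 + (![0, 2, 3, 8, 35] : Fin 5 → ℕ) 4)).card = 14 by decide] at h4
  norm_num at h0 h1 h2 h3 h4
  exact ⟨by linarith, by linarith, by linarith, by linarith, by linarith⟩

end Summit.ValiantsHypothesis.ValiantsHypothesis.Theorems.LacunarySymmetroidMatrixDescartes.Census
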